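import Summits.Ventures.WeilGRH.KeyOneVectorPrinciple
import HarnessLib

/-!
# GRH arm (rh-explicit, venture WeilGRH): the one-vector principle on the CHARACTER TORUS below `(log 5)/2`

Cell `rh-explicit`, WEIL TRACK — GRH ARM, sequel of `KeyOneVectorPrinciple.lean`.  There the maximum
principle is stated for UNCONSTRAINED data `‖v(n)‖ ≤ 1` (each visible `n` anti-aligned separately).
Character data are multiplicative: on the windows `[−t, t]` with `e^{2t} ≤ 5` (`N ≤ 4`: the arm's rungs
`(log 3)/2, log 2, 3/4, 4023/5000`) the visible values are `v(2), v(3), v(4) = v(2)²`, a point of the torus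
`{(z₂, z₃)} × {z₂²}` (`‖z_p‖ ≤ 1`, `z_p = 0` allowed).  For a REAL test function `g` with spikes
`a_n(g) = (Λ(n)/√n)·2(g ⋆ g̃)(log n)` the data part of the form is `−a₂ Re z₂ − a₃ Re z₃ − a₄ Re z₂²`
(`weilFinitePrimeQuadraticKey_eq_of_real`), and on the torus

  `−a₂ Re z − a₄ Re z² ≤ a₂ − a₄`  for `‖z‖ ≤ 1`  iff it holds at `z = −1`, which is the case when
  **`a₂ ≥ 4a₄ ≥ 0`** (`torus_coupling_le`: `−a₂x − a₄(x² − y²) − (a₂ − a₄) = −(1+x)(a₂ − 2a₄(1−x)) − a₄(1 − x² − y²) ≤ 0`),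

so (`weilFinitePrimeQuadraticKey_le_of_real_torus_four`): if `a₂(g) ≥ 4a₄(g) ≥ 0` and `a₃(g) ≥ 0`, the
datum `v⋆` with `v⋆(2) = v⋆(3) = −1`, `v⋆(4) = 1` — the values of the Legendre character `(5/·)` — has the
LARGEST form `E_{a,L,·,4}(g)` among all torus data; with `N = 3` (`t = log 2`) and `N = 2` (`t = (log 3)/2`)
only `a₂(g), a₃(g) ≥ 0` resp. `a₂(g) ≥ 0` are needed and the data are unconstrained
(`weilFinitePrimeQuadraticKey_le_of_real_three`, `_two`).  Consequently (`keyMargin_le_of_real_torus_four`)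
every margin of every torus key on the window `[−(log 5)/2, (log 5)/2]` is at most the Rayleigh quotient of
`g` at `v⋆`: the arm's «the (5/·) phases are the worst case for every visible prime, because
`a₂ ≥ 4a₄ ≥ 0` and `a₃ > 0`» (weil-grh-4 gen6, GRH/STRUCTURE §16(f) add. 5) in Lean, generic in `g`;
the instance supplies the certified vector and the three sign checks.
Everything is PROVED; no named facts; RH/GRH-free.

## References
* A. Weil, *Sur les "formules explicites" de la théorie des nombres premiers* (1952), (11) pp. 261–262.
  [Weil1952FormulesExplicites]
* Cell record: rh-explicit HOME `GRH/STRUCTURE.md` §16(f) addendum 5 (weil-grh-4 gen6, sha16 9444f058530d8833).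
-/

noncomputable section

open Complex Set MeasureTheory
open scoped Real ArithmeticFunction.vonMangoldt ComplexConjugate

namespace Summit.Ventures.WeilGRH

open Literature.NumberTheory.LFunctions

variable {g : ℝ → ℂ}

/-! ## The two elementary inequalities -/

/-- One free value: `‖z‖ ≤ 1`, `0 ≤ a` ⇒ `−a ≤ a·Re z`. [folklore] -/
theorem neg_le_mul_re_of_norm_le_one {z : ℂ} (hz : ‖z‖ ≤ 1) {a : ℝ} (ha : 0 ≤ a) : -a ≤ a * z.re := by
  have h := (abs_le.1 ((Complex.abs_re_le_norm z).trans hz)).1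
  nlinarith

/-- **The torus coupling at `n = 2, 4`**: for `‖z‖ ≤ 1` and `a₂ ≥ 4a₄ ≥ 0`,
`−a₂ + a₄ ≤ a₂ Re z + a₄ Re z²` (the value at `z = −1` is the minimum of the right side over the closed
disc: `a₂(1+x) + a₄(x² − y² − 1) = (1+x)(a₂ − 2a₄(1−x)) + a₄(1 − x² − y²) − … ≥ 0`). [folklore] -/
theorem torus_coupling_le {z : ℂ} (hz : ‖z‖ ≤ 1) {a₂ a₄ : ℝ} (h4 : 0 ≤ a₄) (h24 : 4 * a₄ ≤ a₂) :
    -a₂ + a₄ ≤ a₂ * z.re + a₄ * (z ^ 2).re := by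
  have hn : z.re * z.re + z.im * z.im ≤ 1 := by
    have h1 : ‖z‖ ^ 2 ≤ 1 := by nlinarith [norm_nonneg z]
    rw [Complex.sq_norm, Complex.normSq_apply] at h1
    exact h1
  have hre : (z ^ 2).re = z.re * z.re - z.im * z.im := by
    rw [sq, Complex.mul_re]
  rw [hre]
  have hx1 : -1 ≤ z.re := by nlinarith [sq_nonneg z.im]
  have p1 : 0 ≤ a₄ * (z.re + 1) := mul_nonneg h4 (by linarith)
  have p2 : 0 ≤ a₂ + 2 * a₄ * z.re - 2 * a₄ := by linarith
  have p3 : 0 ≤ (1 + z.re) * (a₂ + 2 * a₄ * z.re - 2 * a₄) := mul_nonneg (by linarith) p2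
  have p4 : 0 ≤ a₄ * (1 - z.re * z.re - z.im * z.im) := mul_nonneg h4 (by linarith)
  nlinarith [p3, p4]

/-! ## The data part of the form on the windows `N = 2, 3, 4` -/

/-- The spike sum of a real test function on `N ≤ 4` visible integers, written out
(`Λ(0) = Λ(1) = 0`). [folklore] -/
private theorem spike_sum_four (v : ℕ → ℂ) (c : ℕ → ℝ) :
    ∑ n ∈ Finset.range (4 + 1), (Λ n : ℝ) / Real.sqrt n * c n * (v n).re =
      (Λ 2 : ℝ) / Real.sqrt 2 * c 2 * (v 2).re + (Λ 3 : ℝ) / Real.sqrt 3 * c 3 * (v 3).re +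
        (Λ 4 : ℝ) / Real.sqrt 4 * c 4 * (v 4).re := by
  simp [Finset.sum_range_succ, ArithmeticFunction.vonMangoldt_apply_one]

/-- The same with `N = 3`. [folklore] -/
private theorem spike_sum_three (v : ℕ → ℂ) (c : ℕ → ℝ) :
    ∑ n ∈ Finset.range (3 + 1), (Λ n : ℝ) / Real.sqrt n * c n * (v n).re =
      (Λ 2 : ℝ) / Real.sqrt 2 * c 2 * (v 2).re + (Λ 3 : ℝ) / Real.sqrt 3 * c 3 * (v 3).re := by
  simp [Finset.sum_range_succ, ArithmeticFunction.vonMangoldt_apply_one]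

/-- The same with `N = 2`. [folklore] -/
private theorem spike_sum_two (v : ℕ → ℂ) (c : ℕ → ℝ) :
    ∑ n ∈ Finset.range (2 + 1), (Λ n : ℝ) / Real.sqrt n * c n * (v n).re =
      (Λ 2 : ℝ) / Real.sqrt 2 * c 2 * (v 2).re := by
  simp [Finset.sum_range_succ, ArithmeticFunction.vonMangoldt_apply_one]

/-! ## The maximum principle on the torus -/

/-- **THE (5/·) PHASES ARE THE WORST CASE ON `[−(log 5)/2, (log 5)/2]`.**  Let `g` be a real test function
with spikes `a_n = (Λ(n)/√n)·2(g ⋆ g̃)(log n)` satisfying `a₂ ≥ 4a₄ ≥ 0` and `a₃ ≥ 0`.  Then for every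
torus datum (`‖v(2)‖, ‖v(3)‖ ≤ 1`, `v(4) = v(2)²`) and the datum `v⋆(2) = v⋆(3) = −1`, `v⋆(4) = 1`:
`E_{a,L,v,4}(g) ≤ E_{a,L,v⋆,4}(g)`. [folklore] -/
theorem weilFinitePrimeQuadraticKey_le_of_real_torus_four (hg : IsWeilTest g)
    (hreal : ∀ t, conj (g t) = g t) (a : ℕ) (L : ℝ) {v vstar : ℕ → ℂ}
    (hv2 : ‖v 2‖ ≤ 1) (hv3 : ‖v 3‖ ≤ 1) (hv4 : v 4 = v 2 ^ 2)
    (hs2 : vstar 2 = -1) (hs3 : vstar 3 = -1) (hs4 : vstar 4 = 1)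
    (h3 : 0 ≤ (Λ 3 : ℝ) / Real.sqrt 3 * (2 * (weilConv g (weilReflect g) (Real.log 3)).re))
    (h4 : 0 ≤ (Λ 4 : ℝ) / Real.sqrt 4 * (2 * (weilConv g (weilReflect g) (Real.log 4)).re))
    (h24 : 4 * ((Λ 4 : ℝ) / Real.sqrt 4 * (2 * (weilConv g (weilReflect g) (Real.log 4)).re)) ≤
      (Λ 2 : ℝ) / Real.sqrt 2 * (2 * (weilConv g (weilReflect g) (Real.log 2)).re)) :
    weilFinitePrimeQuadraticKey a L v 4 g ≤ weilFinitePrimeQuadraticKey a L vstar 4 g := by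
  rw [weilFinitePrimeQuadraticKey_eq_of_real hg hreal a L v 4,
    weilFinitePrimeQuadraticKey_eq_of_real hg hreal a L vstar 4]
  refine sub_le_sub_left ?_ _
  rw [spike_sum_four v (fun n ↦ 2 * (weilConv g (weilReflect g) (Real.log n)).re),
    spike_sum_four vstar (fun n ↦ 2 * (weilConv g (weilReflect g) (Real.log n)).re)]
  simp only [hs2, hs3, hs4, hv4, Complex.neg_re, Complex.one_re, Nat.cast_ofNat]
  have hc := torus_coupling_le hv2 h4 h24
  have h3' := neg_le_mul_re_of_norm_le_one hv3 h3
  linarith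

/-- `N = 3` (`t = log 2`): visible `2, 3`, unconstrained; `a₂, a₃ ≥ 0` suffice. [folklore] -/
theorem weilFinitePrimeQuadraticKey_le_of_real_three (hg : IsWeilTest g)
    (hreal : ∀ t, conj (g t) = g t) (a : ℕ) (L : ℝ) {v vstar : ℕ → ℂ}
    (hv2 : ‖v 2‖ ≤ 1) (hv3 : ‖v 3‖ ≤ 1) (hs2 : vstar 2 = -1) (hs3 : vstar 3 = -1)
    (h2 : 0 ≤ (Λ 2 : ℝ) / Real.sqrt 2 * (2 * (weilConv g (weilReflect g) (Real.log 2)).re))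
    (h3 : 0 ≤ (Λ 3 : ℝ) / Real.sqrt 3 * (2 * (weilConv g (weilReflect g) (Real.log 3)).re)) :
    weilFinitePrimeQuadraticKey a L v 3 g ≤ weilFinitePrimeQuadraticKey a L vstar 3 g := by
  rw [weilFinitePrimeQuadraticKey_eq_of_real hg hreal a L v 3,
    weilFinitePrimeQuadraticKey_eq_of_real hg hreal a L vstar 3]
  refine sub_le_sub_left ?_ _
  rw [spike_sum_three v (fun n ↦ 2 * (weilConv g (weilReflect g) (Real.log n)).re),
    spike_sum_three vstar (fun n ↦ 2 * (weilConv g (weilReflect g) (Real.log n)).re)]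
  simp only [hs2, hs3, Complex.neg_re, Complex.one_re, Nat.cast_ofNat]
  have h2' := neg_le_mul_re_of_norm_le_one hv2 h2
  have h3' := neg_le_mul_re_of_norm_le_one hv3 h3
  linarith

/-- `N = 2` (`t = (log 3)/2`): visible `2` only; `a₂ ≥ 0` suffices. [folklore] -/
theorem weilFinitePrimeQuadraticKey_le_of_real_two (hg : IsWeilTest g)
    (hreal : ∀ t, conj (g t) = g t) (a : ℕ) (L : ℝ) {v vstar : ℕ → ℂ}
    (hv2 : ‖v 2‖ ≤ 1) (hs2 : vstar 2 = -1)
    (h2 : 0 ≤ (Λ 2 : ℝ) / Real.sqrt 2 * (2 * (weilConv g (weilReflect g) (Real.log 2)).re)) :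
    weilFinitePrimeQuadraticKey a L v 2 g ≤ weilFinitePrimeQuadraticKey a L vstar 2 g := by
  rw [weilFinitePrimeQuadraticKey_eq_of_real hg hreal a L v 2,
    weilFinitePrimeQuadraticKey_eq_of_real hg hreal a L vstar 2]
  refine sub_le_sub_left ?_ _
  rw [spike_sum_two v (fun n ↦ 2 * (weilConv g (weilReflect g) (Real.log n)).re),
    spike_sum_two vstar (fun n ↦ 2 * (weilConv g (weilReflect g) (Real.log n)).re)]
  simp only [hs2, Complex.neg_re, Complex.one_re, Nat.cast_ofNat]
  have h2' := neg_le_mul_re_of_norm_le_one hv2 h2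
  linarith

/-- **Margins on the torus are bounded by one vector** (`N = 4`, window `[−(log 5)/2, (log 5)/2]`): if
`c‖h‖₂² ≤ E_{a,L,v,4}(h)` for every test `h` on the window, for SOME torus datum `v`, and `g` is a real test
function on the window with `a₂(g) ≥ 4a₄(g) ≥ 0`, `a₃(g) ≥ 0`, then `c‖g‖₂² ≤ E_{a,L,v⋆,4}(g)` for the
`(5/·)`-valued datum `v⋆`. [folklore] -/
theorem keyMargin_le_of_real_torus_four (hg : IsWeilTest g) (hreal : ∀ t, conj (g t) = g t)
    (hsupp : tsupport g ⊆ Icc (-(Real.log ((4 : ℕ) + 1 : ℝ) / 2)) (Real.log ((4 : ℕ) + 1 : ℝ) / 2))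
    (a : ℕ) (L : ℝ) {v vstar : ℕ → ℂ}
    (hv2 : ‖v 2‖ ≤ 1) (hv3 : ‖v 3‖ ≤ 1) (hv4 : v 4 = v 2 ^ 2)
    (hs2 : vstar 2 = -1) (hs3 : vstar 3 = -1) (hs4 : vstar 4 = 1)
    (h3 : 0 ≤ (Λ 3 : ℝ) / Real.sqrt 3 * (2 * (weilConv g (weilReflect g) (Real.log 3)).re))
    (h4 : 0 ≤ (Λ 4 : ℝ) / Real.sqrt 4 * (2 * (weilConv g (weilReflect g) (Real.log 4)).re))
    (h24 : 4 * ((Λ 4 : ℝ) / Real.sqrt 4 * (2 * (weilConv g (weilReflect g) (Real.log 4)).re)) ≤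
      (Λ 2 : ℝ) / Real.sqrt 2 * (2 * (weilConv g (weilReflect g) (Real.log 2)).re))
    {c : ℝ} (hc : ∀ h : ℝ → ℂ, IsWeilTest h →
      tsupport h ⊆ Icc (-(Real.log ((4 : ℕ) + 1 : ℝ) / 2)) (Real.log ((4 : ℕ) + 1 : ℝ) / 2) →
      c * weilNorm2Sq h ≤ weilFinitePrimeQuadraticKey a L v 4 h) :
    c * weilNorm2Sq g ≤ weilFinitePrimeQuadraticKey a L vstar 4 g :=
  (hc g hg hsupp).trans
    (weilFinitePrimeQuadraticKey_le_of_real_torus_four hg hreal a L hv2 hv3 hv4 hs2 hs3 hs4 h3 h4 h24)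

/-- The Legendre character mod `5` realises `v⋆`: `(5/2) = (5/3) = −1`, `(5/4) = 1` — so for a quadratic
character data `v = χ` (values in `{0, ±1}`, `χ(4) = χ(2)²`) the hypotheses `hv2–hv4` hold and `(5/·)` is
the extremal torus point. [folklore] -/
theorem torus_data_of_mulChar {q : ℕ} (χ : DirichletCharacter ℂ q) :
    ‖χ (2 : ZMod q)‖ ≤ 1 ∧ ‖χ (3 : ZMod q)‖ ≤ 1 ∧ χ (4 : ZMod q) = χ (2 : ZMod q) ^ 2 := by
  refine ⟨χ.norm_le_one _, χ.norm_le_one _, ?_⟩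
  rw [← map_pow]
  congr 1
  norm_num

end Summit.Ventures.WeilGRH
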